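import Summits.QuantumFields.YangMills.Theorems.BalabanUVNodesN18AvgRemainderUnitsPrelim
import HarnessLib

/-!
# BalabanUVNodes ∕ node N18 = NE5 — closure-ledger item (iii), (R3): THE LIPSCHITZ TWIN OF THE SECOND-ORDER REMAINDER OF THE UNGUARDED (0.4) AVERAGE ON THE
# UNITS CARRIER `GL_N(ℂ) ⊂ M_N(ℂ)` (module 25ᶜ, one complex leg allowed), BY THE CAUCHY ROAD
# (Track A, DAG node N18 = `T4OutputRate.NE5` :211; cluster K4 «SpineRates», item K3⁷ `SpineGivenEndpointR13SepCoPH`; seat pub-ymgap-dag-n18-w3 g3)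

CREDIT.  Homes the LENS seat's farm-checked scratch `ym-lens-BalabanUVNodes-transfer` g31 `LensTransferSketch31.lean` (memo `LENS-transfer.md` §37, Card T48; bus
2026-08-27 [LENS-TRANSFER-G31]) per its close-out pointer «home the files `--kind proof --supports 20544 --as helper` WITH CREDIT» (g35, [LENS-TRANSFER-G35-0] (3)).
The mathematics and the proofs are the lens's; the re-cut for the tree is this seat's: NO new definitions — the chart family is the tree's
`Beta.BackgroundVertices.expUnit ℂ` bondwise, the remainder functional `R_c(S) := Ū(S)(c) − 1 − (Q₁(S − 1))(c)` is written out (as in dag-n18-d's module 25), the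
two-block zero extension is a proof device.

HONEST FRAMING.  Count-neutral kernel bookkeeping (`--supports stmt-QuantumFields-20544 --as helper`): one Schwarz-on-lines call on UST's holomorphy + C⁰ bound;
nothing of Bałaban's analysis asserted beyond the cited tree theorems; constants not optimised (`21120`∕`84480` vs module 25's `181`: absorbed in the envelope
constant of the radii family L's bootstrap); the chart-in∕chart-out letters, the (1.12)∕(1.13) letters, `TΦ`∕`Tcfg`∕`w` are NOT here; NE5 NOT PRINTED ∕ NOT
proved; N18 NOT discharged; finite tori — nothing about the continuum ∕ OS ∕ mass gap ∕ Clay.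

WHY (lens memo §37).  Item 3 of `N18-BETA-SPEC.md` (the (1.13) half, ORBIT form) averages ONE small units-valued field per cube with a complex leg: the carrier is
`(M_N(ℂ))ˣ`, not `SU(N)`.  dag-n18-d's (β2) Lipschitz remainder `norm_avgRem_sub_avgRem_le` (module 25, `181ℓ²δ·sup‖U − U′‖`) is the `SU(N) × SU(N)` REAL edition
with the GUARDED average and does not cover that carrier.  King's engine ([King1986] (3.43)–(3.47): the fluctuation functionals are ANALYTIC and every Lipschitz
letter is a Cauchy estimate) gives the complex-leg twin WITHOUT re-running the telescoping: `Y ↦ R_c(e^Y)` is G-holomorphic on the sup-ball of bond fields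
(UST `Prop8Chart.differentiableAt_coe_emlAvgU_of_twoBlock` + `exp_analytic`) with the QUADRATIC sup bound `660ℓ²s²` (UST `Prop8Chart.norm_emlAvgU_sub_one_sub_linAvg_le`),
so ONE application of `Literature.Analysis.Complex.GateauxHolomorphic.norm_sub_le_of_gateaux` gives the twin with the right smallness factor.

WHAT (§0–§2 are FILE A `…N18AvgRemainderUnitsPrelim`; this file = §3–§7).
* §0 `norm_sub_le_of_quadratic_remainder` — the Cauchy road: G-holomorphic + `‖R‖ ≤ K(2δ)²` on the `2δ`-ball ⇒ `8Kδ`-Lipschitz between `δ`-close points of the `δ`-ball.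
* §1 the chart `b ↦ e^{Y(b)}` in the units (`expUnit ℂ`): `coe_expUnit`, `differentiableAt_coe_expUnit`, `norm_coe_expUnit_sub_one_le`.
* §2 `differentiableAt_walkSum_of_steps`, `walkSum_congr`, `differentiableAt_linAvg`, `linAvg_congr₂` (signed sums ∕ `Q₁` differentiable and two-block local).
* §3 the remainder `R_c(S) = Ū(S)(c) − 1 − Q₁(S − 1)(c)` (written out): `avgRemU_congr₂` (two-block local), and in the chart `S = e^Y`: `one_le_ell`,
  `differentiableAt_avgRemE` (`8ℓr < 1`), `norm_avgRemE_le` (`≤ 2640ℓ²r²`, `96ℓr ≤ 1`), `avgRemE_congr₂`.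
* §4 ★ `norm_avgRemE_sub_avgRemE_le_of_lt` (Cauchy case), ★ `norm_avgRemE_sub_avgRemE_le`: `‖Y‖, ‖Y′‖ ≤ δ`, `192ℓδ ≤ 1` ⟹
  `‖R_c(e^{Y′}) − R_c(e^{Y})‖ ≤ 21120·ℓ²·δ·‖Y′ − Y‖`, ALL `M_N(ℂ)`-valued `Y` (`ℓ = (d+2)L`, sup norms).
* §5 ★ `norm_avgRemE_sub_avgRemE_le_local` (two-block hypotheses only).
* §6 ★★ `norm_avgRemU_sub_avgRemU_le` — NO CHART, module 25's letters on the units carrier: `‖S(b) − 1‖, ‖S′(b) − 1‖ ≤ s`, `‖S′(b) − S(b)‖ ≤ ε` two-block,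
  `384ℓs ≤ 1` ⟹ `‖R_c(S′) − R_c(S)‖ ≤ 84480·ℓ²·s·ε`.
* §7 `avgRemU_unitsField_eq` — the `SU(N)` leg on the guard IS module 25's remainder with the GUARDED average (UST (T1) `coe_emlAvgU_unitsField`).

0 `def`, 0 `sorry`.  References: C. King, CMP **102** (1986) 649–677 [King1986] ((3.43)–(3.47) p.661); T. Bałaban, CMP **98** (1985) 17–51 [Balaban1985Averaging]
(Prop. 3 (122)–(125) p.36); CMP **109** (1987) 249–301 [Balaban1987RG1] ((0.4) p.253, (1.12) p.262).
-/

noncomputable section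

open scoped BigOperators
open NormedSpace Metric Set

namespace YMDAG.N18.AvgRemainderUnits

open Literature.MathematicalPhysics.QuantumFieldTheory.Balaban1983to89
open T4Continuum BlockAveraging AveragingRT ExpMeanLog MatrixLog BlockAveragingEMLLinearised
open Summit.QuantumFields.YangMills.Theorems.Prop8Chart
open Literature.Analysis.Complex
open Beta.BackgroundVertices (expUnit)

variable {P : Params} {j : ℕ}

/-! ## §3  The second-order remainder `R_c(S) = Ū(S)(c) − 1 − (Q₁(S − 1))(c)` of the unguarded average (written out) and its exponential chart -/

section Rem

open scoped Matrix.Norms.L2Operator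

variable {n : Type*} [Fintype n] [DecidableEq n] [Nonempty n]

omit [Nonempty n] in
/-- **THE REMAINDER FUNCTIONAL `R_c(S) := Ū(S)(c) − 1 − (Q₁(S − 1))(c)` IS TWO-BLOCK LOCAL** (`Ū = Prop8Chart.emlAvgU`, `Q₁ = linAvg`; UST `emlAvgU_congr₂` +
`linAvg_congr₂`). [cite: Balaban1987RG1, (0.4) p.253] -/
theorem avgRemU_congr₂ (hj : j + 1 ≤ P.m + P.K) (c : PBond P (j + 1)) {S S' : GaugeField P j (Matrix n n ℂ)ˣ}
    (h : ∀ b : PBond P j, (blockOf b.src = c.src ∨ blockOf b.src = c.tgt) → (blockOf b.tgt = c.src ∨ blockOf b.tgt = c.tgt) → S b = S' b) :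
    (((emlAvgU S c : (Matrix n n ℂ)ˣ) : Matrix n n ℂ) - 1 - linAvg (fun b => ((S b : (Matrix n n ℂ)ˣ) : Matrix n n ℂ) - 1) c) =
      (((emlAvgU S' c : (Matrix n n ℂ)ˣ) : Matrix n n ℂ) - 1 - linAvg (fun b => ((S' b : (Matrix n n ℂ)ˣ) : Matrix n n ℂ) - 1) c) := by
  rw [emlAvgU_congr₂ hj c h, linAvg_congr₂ hj c (Z := fun b => ((S b : (Matrix n n ℂ)ˣ) : Matrix n n ℂ) - 1)
    (Z' := fun b => ((S' b : (Matrix n n ℂ)ˣ) : Matrix n n ℂ) - 1) fun b h1 h2 => by simp only [h b h1 h2]]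

/-- `ℓ = (d+2)L ≥ 1`. [folklore] -/
theorem one_le_ell : (1 : ℝ) ≤ (((P.d + 2) * P.L : ℕ) : ℝ) := by
  exact_mod_cast Nat.one_le_iff_ne_zero.mpr (Nat.mul_ne_zero (by omega) (by have := P.hL.2; omega))

/-- **THE REMAINDER IS ℂ-DIFFERENTIABLE** at every exponent field within `r` of `0` on the two-block bonds of `c`, `8ℓr < 1`, `r ≤ 1` (UST's local
differentiability of the unguarded average: the loop variables of `e^Y` are within `1` of `1`). [cite: Balaban1987RG1, (0.4) p.253] -/
theorem differentiableAt_avgRemE (hj : j + 1 ≤ P.m + P.K) (c : PBond P (j + 1)) {Y₀ : PBond P j → Matrix n n ℂ} {r : ℝ} (hr0 : 0 ≤ r)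
    (hr1 : r ≤ 1) (hℓr : 8 * (((P.d + 2) * P.L : ℕ) : ℝ) * r < 1)
    (hY₀ : ∀ b : PBond P j, (blockOf b.src = c.src ∨ blockOf b.src = c.tgt) → (blockOf b.tgt = c.src ∨ blockOf b.tgt = c.tgt) → ‖Y₀ b‖ ≤ r) :
    DifferentiableAt ℂ ((fun Y : PBond P j → Matrix n n ℂ => ((emlAvgU (fun b => expUnit ℂ (Y b)) c : (Matrix n n ℂ)ˣ) : Matrix n n ℂ) - 1 - linAvg (fun b => ((expUnit ℂ (Y b) : (Matrix n n ℂ)ˣ) : Matrix n n ℂ) - 1) c)) Y₀ := by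
  have hS : ∀ b : PBond P j, (blockOf b.src = c.src ∨ blockOf b.src = c.tgt) → (blockOf b.tgt = c.src ∨ blockOf b.tgt = c.tgt) →
      ‖((expUnit ℂ (Y₀ b) : (Matrix n n ℂ)ˣ) : Matrix n n ℂ) - 1‖ ≤ 2 * r := fun b h1 h2 =>
    (norm_coe_expUnit_sub_one_le Y₀ b ((hY₀ b h1 h2).trans hr1)).trans (by linarith [hY₀ b h1 h2])
  have h4 : 4 * (((P.d + 2) * P.L : ℕ) : ℝ) * (2 * r) < 1 := by linarith
  have hU : DifferentiableAt ℂ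
      (fun Y : PBond P j → Matrix n n ℂ => ((emlAvgU (fun b => expUnit ℂ (Y b)) c : (Matrix n n ℂ)ˣ) : Matrix n n ℂ)) Y₀ :=
    differentiableAt_coe_emlAvgU_of_twoBlock hj c (F := fun (Y : PBond P j → Matrix n n ℂ) b => expUnit ℂ (Y b))
      (fun b _ _ => differentiableAt_coe_expUnit b Y₀)
      (norm_loopHolU_sub_one_lt_one hj c (s := 2 * r) (by positivity) h4 hS)
  have hL : DifferentiableAt ℂ
      (fun Y : PBond P j → Matrix n n ℂ => linAvg (fun b => ((expUnit ℂ (Y b) : (Matrix n n ℂ)ˣ) : Matrix n n ℂ) - 1) c) Y₀ :=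
    differentiableAt_linAvg c (G := fun (Y : PBond P j → Matrix n n ℂ) b => ((expUnit ℂ (Y b) : (Matrix n n ℂ)ˣ) : Matrix n n ℂ) - 1)
      fun b => (differentiableAt_coe_expUnit b Y₀).sub_const 1
  exact (hU.sub_const 1).sub hL

/-- **THE QUADRATIC SUP BOUND** (UST's Prop. 3 for the unguarded average, read in the chart): `‖R_c(e^Y)‖ ≤ 2640·ℓ²·r²` when `‖Y(b)‖ ≤ r` on the two-block bonds
of `c` and `96ℓr ≤ 1`. [cite: Balaban1985Averaging, Prop. 3 (122)-(125) p.36] -/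
theorem norm_avgRemE_le (hj : j + 1 ≤ P.m + P.K) (c : PBond P (j + 1)) {Y : PBond P j → Matrix n n ℂ} {r : ℝ} (hr0 : 0 ≤ r)
    (hℓr : 96 * (((P.d + 2) * P.L : ℕ) : ℝ) * r ≤ 1)
    (hY : ∀ b : PBond P j, (blockOf b.src = c.src ∨ blockOf b.src = c.tgt) → (blockOf b.tgt = c.src ∨ blockOf b.tgt = c.tgt) → ‖Y b‖ ≤ r) :
    ‖(((emlAvgU (fun b => expUnit ℂ (Y b)) c : (Matrix n n ℂ)ˣ) : Matrix n n ℂ) - 1 - linAvg (fun b => ((expUnit ℂ (Y b) : (Matrix n n ℂ)ˣ) : Matrix n n ℂ) - 1) c)‖ ≤ 2640 * (((P.d + 2) * P.L : ℕ) : ℝ) ^ 2 * r ^ 2 := by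
  have hℓ1 := one_le_ell (P := P)
  have hr1 : r ≤ 1 := by nlinarith
  have hS : ∀ b : PBond P j, (blockOf b.src = c.src ∨ blockOf b.src = c.tgt) → (blockOf b.tgt = c.src ∨ blockOf b.tgt = c.tgt) →
      ‖((expUnit ℂ (Y b) : (Matrix n n ℂ)ˣ) : Matrix n n ℂ) - 1‖ ≤ 2 * r := fun b h1 h2 =>
    (norm_coe_expUnit_sub_one_le Y b ((hY b h1 h2).trans hr1)).trans (by linarith [hY b h1 h2])
  have h := (norm_emlAvgU_sub_one_sub_linAvg_le hj (S := fun b => expUnit ℂ (Y b)) c (s := 2 * r) (by positivity) (by linarith) hS).1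
  calc ‖(((emlAvgU (fun b => expUnit ℂ (Y b)) c : (Matrix n n ℂ)ˣ) : Matrix n n ℂ) - 1 - linAvg (fun b => ((expUnit ℂ (Y b) : (Matrix n n ℂ)ˣ) : Matrix n n ℂ) - 1) c)‖ ≤ 660 * (((P.d + 2) * P.L : ℕ) : ℝ) ^ 2 * (2 * r) ^ 2 := h
    _ = 2640 * (((P.d + 2) * P.L : ℕ) : ℝ) ^ 2 * r ^ 2 := by ring

omit [Nonempty n] in
/-- **THE REMAINDER IS TWO-BLOCK LOCAL** (UST `emlAvgU_congr₂` + `linAvg_congr₂`). [cite: Balaban1987RG1, (0.4) p.253] -/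
theorem avgRemE_congr₂ (hj : j + 1 ≤ P.m + P.K) (c : PBond P (j + 1)) {Y Y' : PBond P j → Matrix n n ℂ}
    (h : ∀ b : PBond P j, (blockOf b.src = c.src ∨ blockOf b.src = c.tgt) → (blockOf b.tgt = c.src ∨ blockOf b.tgt = c.tgt) → Y b = Y' b) :
    (((emlAvgU (fun b => expUnit ℂ (Y b)) c : (Matrix n n ℂ)ˣ) : Matrix n n ℂ) - 1 - linAvg (fun b => ((expUnit ℂ (Y b) : (Matrix n n ℂ)ˣ) : Matrix n n ℂ) - 1) c) = (((emlAvgU (fun b => expUnit ℂ (Y' b)) c : (Matrix n n ℂ)ˣ) : Matrix n n ℂ) - 1 - linAvg (fun b => ((expUnit ℂ (Y' b) : (Matrix n n ℂ)ˣ) : Matrix n n ℂ) - 1) c) :=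
  avgRemU_congr₂ hj c fun b h1 h2 => by
    apply Units.ext
    rw [coe_expUnit, coe_expUnit, h b h1 h2]

/-! ## §4  ★ The Lipschitz twin by the Cauchy road -/

/-- **THE CAUCHY CASE**: for exponent fields `Y` in the closed `δ`-ball (sup norm over all bonds) and `Y′` with `‖Y′ − Y‖ < δ`, `192ℓδ ≤ 1`:
`‖R_c(e^{Y′}) − R_c(e^{Y})‖ ≤ 21120·ℓ²·δ·‖Y′ − Y‖` — the remainder is G-holomorphic on the `2δ`-ball with sup bound `2640ℓ²(2δ)²` there, and §0 applies.
[cite: King1986, (3.43)-(3.47) p.661; Balaban1985Averaging, Prop. 3 (122)-(125) p.36] -/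
theorem norm_avgRemE_sub_avgRemE_le_of_lt (hj : j + 1 ≤ P.m + P.K) (c : PBond P (j + 1)) {δ : ℝ} (hδ : 0 < δ)
    (hℓδ : 192 * (((P.d + 2) * P.L : ℕ) : ℝ) * δ ≤ 1) {Y Y' : PBond P j → Matrix n n ℂ} (hY : ‖Y‖ ≤ δ) (hY' : ‖Y' - Y‖ < δ) :
    ‖(((emlAvgU (fun b => expUnit ℂ (Y' b)) c : (Matrix n n ℂ)ˣ) : Matrix n n ℂ) - 1 - linAvg (fun b => ((expUnit ℂ (Y' b) : (Matrix n n ℂ)ˣ) : Matrix n n ℂ) - 1) c) - (((emlAvgU (fun b => expUnit ℂ (Y b)) c : (Matrix n n ℂ)ˣ) : Matrix n n ℂ) - 1 - linAvg (fun b => ((expUnit ℂ (Y b) : (Matrix n n ℂ)ˣ) : Matrix n n ℂ) - 1) c)‖ ≤ 21120 * (((P.d + 2) * P.L : ℕ) : ℝ) ^ 2 * δ * ‖Y' - Y‖ := by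
  have hℓ1 := one_le_ell (P := P)
  have hδ1 : 2 * δ ≤ 1 := by nlinarith
  have hM : ∀ y ∈ ball (0 : PBond P j → Matrix n n ℂ) (2 * δ), ‖(((emlAvgU (fun b => expUnit ℂ (y b)) c : (Matrix n n ℂ)ˣ) : Matrix n n ℂ) - 1 - linAvg (fun b => ((expUnit ℂ (y b) : (Matrix n n ℂ)ˣ) : Matrix n n ℂ) - 1) c)‖ ≤ 2640 * (((P.d + 2) * P.L : ℕ) : ℝ) ^ 2 * (2 * δ) ^ 2 :=
    fun y hy => norm_avgRemE_le hj c (r := 2 * δ) (by positivity) (by linarith)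
      fun b _ _ => (norm_le_pi_norm y b).trans (mem_ball_zero_iff.mp hy).le
  have hG : ∀ a ∈ ball (0 : PBond P j → Matrix n n ℂ) (2 * δ), ∀ v : PBond P j → Matrix n n ℂ,
      DifferentiableOn ℂ (fun z : ℂ => ((emlAvgU (fun b => expUnit ℂ ((a + z • v) b)) c : (Matrix n n ℂ)ˣ) : Matrix n n ℂ) - 1 - linAvg (fun b => ((expUnit ℂ ((a + z • v) b) : (Matrix n n ℂ)ˣ) : Matrix n n ℂ) - 1) c) {z : ℂ | a + z • v ∈ ball (0 : PBond P j → Matrix n n ℂ) (2 * δ)} := by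
    intro a _ v z hz
    have hpt : ‖a + z • v‖ < 2 * δ := mem_ball_zero_iff.mp hz
    have hd : DifferentiableAt ℂ ((fun Y : PBond P j → Matrix n n ℂ => ((emlAvgU (fun b => expUnit ℂ (Y b)) c : (Matrix n n ℂ)ˣ) : Matrix n n ℂ) - 1 - linAvg (fun b => ((expUnit ℂ (Y b) : (Matrix n n ℂ)ˣ) : Matrix n n ℂ) - 1) c)) (a + z • v) :=
      differentiableAt_avgRemE hj c (r := 2 * δ) (by positivity) hδ1 (by linarith)
        fun b _ _ => (norm_le_pi_norm _ b).trans hpt.le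
    exact (hd.comp z ((differentiableAt_id.smul_const v).const_add a)).differentiableWithinAt
  have key := norm_sub_le_of_quadratic_remainder (R := (fun Y : PBond P j → Matrix n n ℂ => ((emlAvgU (fun b => expUnit ℂ (Y b)) c : (Matrix n n ℂ)ˣ) : Matrix n n ℂ) - 1 - linAvg (fun b => ((expUnit ℂ (Y b) : (Matrix n n ℂ)ˣ) : Matrix n n ℂ) - 1) c))
    (K := 2640 * (((P.d + 2) * P.L : ℕ) : ℝ) ^ 2) hδ hG hM hY hY'
  calc _ ≤ 8 * (2640 * (((P.d + 2) * P.L : ℕ) : ℝ) ^ 2) * δ * ‖Y' - Y‖ := key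
    _ = _ := by ring

/-- ★ **THE LIPSCHITZ TWIN OF THE SECOND-ORDER REMAINDER ON THE UNITS CARRIER (module 25ᶜ)**: for ALL exponent fields `Y, Y′ : bonds → M_N(ℂ)` in the
closed `δ`-ball, `192ℓδ ≤ 1`: `‖R_c(e^{Y′}) − R_c(e^{Y})‖ ≤ 21120·ℓ²·δ·‖Y′ − Y‖` — one complex leg allowed (the carrier of item 3 of the N18 (β) programme);
the `SU(N)` leg is the restriction to `Y ∈ 𝔰𝔲(N)`.  (Cauchy case `‖Y′ − Y‖ < δ`: the previous theorem; far case `‖Y′ − Y‖ ≥ δ`: two quadratic sup bounds.)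
[cite: King1986, (3.43)-(3.47) p.661; Balaban1985Averaging, Prop. 3 (122)-(125) p.36] -/
theorem norm_avgRemE_sub_avgRemE_le (hj : j + 1 ≤ P.m + P.K) (c : PBond P (j + 1)) {δ : ℝ} (hδ : 0 < δ)
    (hℓδ : 192 * (((P.d + 2) * P.L : ℕ) : ℝ) * δ ≤ 1) {Y Y' : PBond P j → Matrix n n ℂ} (hY : ‖Y‖ ≤ δ) (hY' : ‖Y'‖ ≤ δ) :
    ‖(((emlAvgU (fun b => expUnit ℂ (Y' b)) c : (Matrix n n ℂ)ˣ) : Matrix n n ℂ) - 1 - linAvg (fun b => ((expUnit ℂ (Y' b) : (Matrix n n ℂ)ˣ) : Matrix n n ℂ) - 1) c) - (((emlAvgU (fun b => expUnit ℂ (Y b)) c : (Matrix n n ℂ)ˣ) : Matrix n n ℂ) - 1 - linAvg (fun b => ((expUnit ℂ (Y b) : (Matrix n n ℂ)ˣ) : Matrix n n ℂ) - 1) c)‖ ≤ 21120 * (((P.d + 2) * P.L : ℕ) : ℝ) ^ 2 * δ * ‖Y' - Y‖ := by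
  by_cases hlt : ‖Y' - Y‖ < δ
  · exact norm_avgRemE_sub_avgRemE_le_of_lt hj c hδ hℓδ hY hlt
  · have hge : δ ≤ ‖Y' - Y‖ := le_of_not_gt hlt
    have h1 : ‖(((emlAvgU (fun b => expUnit ℂ (Y b)) c : (Matrix n n ℂ)ˣ) : Matrix n n ℂ) - 1 - linAvg (fun b => ((expUnit ℂ (Y b) : (Matrix n n ℂ)ˣ) : Matrix n n ℂ) - 1) c)‖ ≤ 2640 * (((P.d + 2) * P.L : ℕ) : ℝ) ^ 2 * δ ^ 2 :=
      norm_avgRemE_le hj c hδ.le (by linarith) fun b _ _ => (norm_le_pi_norm Y b).trans hY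
    have h2 : ‖(((emlAvgU (fun b => expUnit ℂ (Y' b)) c : (Matrix n n ℂ)ˣ) : Matrix n n ℂ) - 1 - linAvg (fun b => ((expUnit ℂ (Y' b) : (Matrix n n ℂ)ˣ) : Matrix n n ℂ) - 1) c)‖ ≤ 2640 * (((P.d + 2) * P.L : ℕ) : ℝ) ^ 2 * δ ^ 2 :=
      norm_avgRemE_le hj c hδ.le (by linarith) fun b _ _ => (norm_le_pi_norm Y' b).trans hY'
    have hℓ2 : 0 ≤ (((P.d + 2) * P.L : ℕ) : ℝ) ^ 2 := sq_nonneg _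
    calc ‖(((emlAvgU (fun b => expUnit ℂ (Y' b)) c : (Matrix n n ℂ)ˣ) : Matrix n n ℂ) - 1 - linAvg (fun b => ((expUnit ℂ (Y' b) : (Matrix n n ℂ)ˣ) : Matrix n n ℂ) - 1) c) - (((emlAvgU (fun b => expUnit ℂ (Y b)) c : (Matrix n n ℂ)ˣ) : Matrix n n ℂ) - 1 - linAvg (fun b => ((expUnit ℂ (Y b) : (Matrix n n ℂ)ˣ) : Matrix n n ℂ) - 1) c)‖ ≤ ‖(((emlAvgU (fun b => expUnit ℂ (Y' b)) c : (Matrix n n ℂ)ˣ) : Matrix n n ℂ) - 1 - linAvg (fun b => ((expUnit ℂ (Y' b) : (Matrix n n ℂ)ˣ) : Matrix n n ℂ) - 1) c)‖ + ‖(((emlAvgU (fun b => expUnit ℂ (Y b)) c : (Matrix n n ℂ)ˣ) : Matrix n n ℂ) - 1 - linAvg (fun b => ((expUnit ℂ (Y b) : (Matrix n n ℂ)ˣ) : Matrix n n ℂ) - 1) c)‖ := norm_sub_le _ _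
      _ ≤ 5280 * (((P.d + 2) * P.L : ℕ) : ℝ) ^ 2 * δ * δ := by nlinarith
      _ ≤ 5280 * (((P.d + 2) * P.L : ℕ) : ℝ) ^ 2 * δ * ‖Y' - Y‖ := by gcongr
      _ ≤ 21120 * (((P.d + 2) * P.L : ℕ) : ℝ) ^ 2 * δ * ‖Y' - Y‖ := by
          nlinarith [mul_nonneg (mul_nonneg hℓ2 hδ.le) (norm_nonneg (Y' - Y))]
/-! ## §5  ★ The two-block LOCAL edition (module 25's shape; the zero extension off the two blocks is a proof device) -/

/-- ★ **MODULE 25ᶜ, LOCAL SHAPE**: if `‖Y(b)‖, ‖Y′(b)‖ ≤ δ` and `‖Y′(b) − Y(b)‖ ≤ ε` on the two-block bonds of `c`, `192ℓδ ≤ 1`, then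
`‖R_c(e^{Y′}) − R_c(e^{Y})‖ ≤ 21120·ℓ²·δ·ε` — for ALL `M_N(ℂ)`-valued exponent fields (one complex leg allowed).  Compare dag-n18-d module 25
`norm_avgRem_sub_avgRem_le` (`181ℓ²δ·ε`, `SU(N) × SU(N)` only). [cite: King1986, (3.43)-(3.47) p.661; Balaban1985Averaging, Prop. 3 (122)-(125) p.36] -/
theorem norm_avgRemE_sub_avgRemE_le_local (hj : j + 1 ≤ P.m + P.K) (c : PBond P (j + 1)) {δ ε : ℝ} (hδ : 0 < δ) (hε : 0 ≤ ε)
    (hℓδ : 192 * (((P.d + 2) * P.L : ℕ) : ℝ) * δ ≤ 1) {Y Y' : PBond P j → Matrix n n ℂ}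
    (hY : ∀ b : PBond P j, (blockOf b.src = c.src ∨ blockOf b.src = c.tgt) → (blockOf b.tgt = c.src ∨ blockOf b.tgt = c.tgt) → ‖Y b‖ ≤ δ)
    (hY' : ∀ b : PBond P j, (blockOf b.src = c.src ∨ blockOf b.src = c.tgt) → (blockOf b.tgt = c.src ∨ blockOf b.tgt = c.tgt) → ‖Y' b‖ ≤ δ)
    (hd : ∀ b : PBond P j, (blockOf b.src = c.src ∨ blockOf b.src = c.tgt) → (blockOf b.tgt = c.src ∨ blockOf b.tgt = c.tgt) → ‖Y' b - Y b‖ ≤ ε) :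
    ‖(((emlAvgU (fun b => expUnit ℂ (Y' b)) c : (Matrix n n ℂ)ˣ) : Matrix n n ℂ) - 1 - linAvg (fun b => ((expUnit ℂ (Y' b) : (Matrix n n ℂ)ˣ) : Matrix n n ℂ) - 1) c) -
        (((emlAvgU (fun b => expUnit ℂ (Y b)) c : (Matrix n n ℂ)ˣ) : Matrix n n ℂ) - 1 - linAvg (fun b => ((expUnit ℂ (Y b) : (Matrix n n ℂ)ˣ) : Matrix n n ℂ) - 1) c)‖ ≤
      21120 * (((P.d + 2) * P.L : ℕ) : ℝ) ^ 2 * δ * ε := by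
  classical
  -- the zero extensions off the two-block bonds of `c`
  set Z : PBond P j → Matrix n n ℂ := fun b =>
    if (blockOf b.src = c.src ∨ blockOf b.src = c.tgt) ∧ (blockOf b.tgt = c.src ∨ blockOf b.tgt = c.tgt) then Y b else 0 with hZ
  set Z' : PBond P j → Matrix n n ℂ := fun b =>
    if (blockOf b.src = c.src ∨ blockOf b.src = c.tgt) ∧ (blockOf b.tgt = c.src ∨ blockOf b.tgt = c.tgt) then Y' b else 0 with hZ'
  have hZon : ∀ b : PBond P j, (blockOf b.src = c.src ∨ blockOf b.src = c.tgt) → (blockOf b.tgt = c.src ∨ blockOf b.tgt = c.tgt) → Z b = Y b :=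
    fun b h1 h2 => by simp only [hZ, if_pos (And.intro h1 h2)]
  have hZ'on : ∀ b : PBond P j, (blockOf b.src = c.src ∨ blockOf b.src = c.tgt) → (blockOf b.tgt = c.src ∨ blockOf b.tgt = c.tgt) → Z' b = Y' b :=
    fun b h1 h2 => by simp only [hZ', if_pos (And.intro h1 h2)]
  have hnZ : ‖Z‖ ≤ δ := by
    refine (pi_norm_le_iff_of_nonneg hδ.le).mpr fun b => ?_
    by_cases hb : (blockOf b.src = c.src ∨ blockOf b.src = c.tgt) ∧ (blockOf b.tgt = c.src ∨ blockOf b.tgt = c.tgt)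
    · rw [hZon b hb.1 hb.2]; exact hY b hb.1 hb.2
    · simp only [hZ, if_neg hb, norm_zero]; exact hδ.le
  have hnZ' : ‖Z'‖ ≤ δ := by
    refine (pi_norm_le_iff_of_nonneg hδ.le).mpr fun b => ?_
    by_cases hb : (blockOf b.src = c.src ∨ blockOf b.src = c.tgt) ∧ (blockOf b.tgt = c.src ∨ blockOf b.tgt = c.tgt)
    · rw [hZ'on b hb.1 hb.2]; exact hY' b hb.1 hb.2
    · simp only [hZ', if_neg hb, norm_zero]; exact hδ.le
  have hn : ‖Z' - Z‖ ≤ ε := by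
    refine (pi_norm_le_iff_of_nonneg hε).mpr fun b => ?_
    rw [Pi.sub_apply]
    by_cases hb : (blockOf b.src = c.src ∨ blockOf b.src = c.tgt) ∧ (blockOf b.tgt = c.src ∨ blockOf b.tgt = c.tgt)
    · rw [hZon b hb.1 hb.2, hZ'on b hb.1 hb.2]; exact hd b hb.1 hb.2
    · simp only [hZ, hZ', if_neg hb, sub_zero, norm_zero]; exact hε
  have e1 : (((emlAvgU (fun b => expUnit ℂ (Y b)) c : (Matrix n n ℂ)ˣ) : Matrix n n ℂ) - 1 - linAvg (fun b => ((expUnit ℂ (Y b) : (Matrix n n ℂ)ˣ) : Matrix n n ℂ) - 1) c) =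
      (((emlAvgU (fun b => expUnit ℂ (Z b)) c : (Matrix n n ℂ)ˣ) : Matrix n n ℂ) - 1 - linAvg (fun b => ((expUnit ℂ (Z b) : (Matrix n n ℂ)ˣ) : Matrix n n ℂ) - 1) c) :=
    avgRemE_congr₂ hj c fun b h1 h2 => (hZon b h1 h2).symm
  have e2 : (((emlAvgU (fun b => expUnit ℂ (Y' b)) c : (Matrix n n ℂ)ˣ) : Matrix n n ℂ) - 1 - linAvg (fun b => ((expUnit ℂ (Y' b) : (Matrix n n ℂ)ˣ) : Matrix n n ℂ) - 1) c) =
      (((emlAvgU (fun b => expUnit ℂ (Z' b)) c : (Matrix n n ℂ)ˣ) : Matrix n n ℂ) - 1 - linAvg (fun b => ((expUnit ℂ (Z' b) : (Matrix n n ℂ)ˣ) : Matrix n n ℂ) - 1) c) :=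
    avgRemE_congr₂ hj c fun b h1 h2 => (hZ'on b h1 h2).symm
  rw [e1, e2]
  calc _ ≤ 21120 * (((P.d + 2) * P.L : ℕ) : ℝ) ^ 2 * δ * ‖Z' - Z‖ := norm_avgRemE_sub_avgRemE_le hj c hδ hℓδ hnZ hnZ'
    _ ≤ 21120 * (((P.d + 2) * P.L : ℕ) : ℝ) ^ 2 * δ * ε := by gcongr

/-! ## §6  ★★ The units-carrier edition in module 25's letters (no chart: `S, S′` units-valued, `s`-close to `1`) -/

/-- ★★ **MODULE 25ᶜ IN MODULE 25's LETTERS**: for units-valued bond fields `S, S′ : bonds → GL_N(ℂ)` with `‖S(b) − 1‖, ‖S′(b) − 1‖ ≤ s` and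
`‖S′(b) − S(b)‖ ≤ ε` on the two-block bonds of `c`, `384ℓs ≤ 1`, `0 < s`:
`‖(Ū(S′)(c) − 1 − Q₁(S′ − 1)(c)) − (Ū(S)(c) − 1 − Q₁(S − 1)(c))‖ ≤ 84480·ℓ²·s·ε` — n18-d's `norm_avgRem_sub_avgRem_le` with `(M_N(ℂ))ˣ` in place of
`SU(N)` and the unguarded `Ū = emlAvgU` in place of `avgFun expMeanLogSU` (they agree on `SU(N)`: UST `coe_emlAvgU_unitsField`).  Proof: chart `Y = log S`
(`MatrixLog.exp_mlog`, `norm_mlog_le_two_mul`, `FederbushMean.norm_mlog_sub_mlog_le`) and §5.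
[cite: King1986, (3.43)-(3.47) p.661; Balaban1985Averaging, Prop. 3 (122)-(125) p.36] -/
theorem norm_avgRemU_sub_avgRemU_le (hj : j + 1 ≤ P.m + P.K) (c : PBond P (j + 1)) {s ε : ℝ} (hs : 0 < s) (hε : 0 ≤ ε)
    (hℓs : 384 * (((P.d + 2) * P.L : ℕ) : ℝ) * s ≤ 1) {S S' : GaugeField P j (Matrix n n ℂ)ˣ}
    (hS : ∀ b : PBond P j, (blockOf b.src = c.src ∨ blockOf b.src = c.tgt) → (blockOf b.tgt = c.src ∨ blockOf b.tgt = c.tgt) →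
      ‖((S b : (Matrix n n ℂ)ˣ) : Matrix n n ℂ) - 1‖ ≤ s)
    (hS' : ∀ b : PBond P j, (blockOf b.src = c.src ∨ blockOf b.src = c.tgt) → (blockOf b.tgt = c.src ∨ blockOf b.tgt = c.tgt) →
      ‖((S' b : (Matrix n n ℂ)ˣ) : Matrix n n ℂ) - 1‖ ≤ s)
    (hd : ∀ b : PBond P j, (blockOf b.src = c.src ∨ blockOf b.src = c.tgt) → (blockOf b.tgt = c.src ∨ blockOf b.tgt = c.tgt) →
      ‖((S' b : (Matrix n n ℂ)ˣ) : Matrix n n ℂ) - ((S b : (Matrix n n ℂ)ˣ) : Matrix n n ℂ)‖ ≤ ε) :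
    ‖(((emlAvgU S' c : (Matrix n n ℂ)ˣ) : Matrix n n ℂ) - 1 - linAvg (fun b => ((S' b : (Matrix n n ℂ)ˣ) : Matrix n n ℂ) - 1) c) - (((emlAvgU S c : (Matrix n n ℂ)ˣ) : Matrix n n ℂ) - 1 - linAvg (fun b => ((S b : (Matrix n n ℂ)ˣ) : Matrix n n ℂ) - 1) c)‖ ≤ 84480 * (((P.d + 2) * P.L : ℕ) : ℝ) ^ 2 * s * ε := by
  have hℓ1 := one_le_ell (P := P)
  have hs2 : s ≤ 1 / 2 := by nlinarith
  have e1 : (((emlAvgU S c : (Matrix n n ℂ)ˣ) : Matrix n n ℂ) - 1 - linAvg (fun b => ((S b : (Matrix n n ℂ)ˣ) : Matrix n n ℂ) - 1) c) = (((emlAvgU (fun b => expUnit ℂ ((fun b => mlog ((S b : (Matrix n n ℂ)ˣ) : Matrix n n ℂ)) b)) c : (Matrix n n ℂ)ˣ) : Matrix n n ℂ) - 1 - linAvg (fun b => ((expUnit ℂ ((fun b => mlog ((S b : (Matrix n n ℂ)ˣ) : Matrix n n ℂ)) b) : (Matrix n n ℂ)ˣ) : Matrix n n ℂ) - 1) c)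 :=
    avgRemU_congr₂ hj c fun b h1 h2 => by
      apply Units.ext
      rw [coe_expUnit, exp_mlog (lt_of_le_of_lt (hS b h1 h2) (by linarith))]
  have e2 : (((emlAvgU S' c : (Matrix n n ℂ)ˣ) : Matrix n n ℂ) - 1 - linAvg (fun b => ((S' b : (Matrix n n ℂ)ˣ) : Matrix n n ℂ) - 1) c) = (((emlAvgU (fun b => expUnit ℂ ((fun b => mlog ((S' b : (Matrix n n ℂ)ˣ) : Matrix n n ℂ)) b)) c : (Matrix n n ℂ)ˣ) : Matrix n n ℂ) - 1 - linAvg (fun b => ((expUnit ℂ ((fun b => mlog ((S' b : (Matrix n n ℂ)ˣ) : Matrix n n ℂ)) b) : (Matrix n n ℂ)ˣ) : Matrix n n ℂ) - 1) c) :=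
    avgRemU_congr₂ hj c fun b h1 h2 => by
      apply Units.ext
      rw [coe_expUnit, exp_mlog (lt_of_le_of_lt (hS' b h1 h2) (by linarith))]
  rw [e1, e2]
  have hY : ∀ b : PBond P j, (blockOf b.src = c.src ∨ blockOf b.src = c.tgt) → (blockOf b.tgt = c.src ∨ blockOf b.tgt = c.tgt) →
      ‖mlog ((S b : (Matrix n n ℂ)ˣ) : Matrix n n ℂ)‖ ≤ 2 * s := fun b h1 h2 =>
    (norm_mlog_le_two_mul ((hS b h1 h2).trans hs2)).trans (by linarith [hS b h1 h2])
  have hY' : ∀ b : PBond P j, (blockOf b.src = c.src ∨ blockOf b.src = c.tgt) → (blockOf b.tgt = c.src ∨ blockOf b.tgt = c.tgt) →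
      ‖mlog ((S' b : (Matrix n n ℂ)ˣ) : Matrix n n ℂ)‖ ≤ 2 * s := fun b h1 h2 =>
    (norm_mlog_le_two_mul ((hS' b h1 h2).trans hs2)).trans (by linarith [hS' b h1 h2])
  have hdY : ∀ b : PBond P j, (blockOf b.src = c.src ∨ blockOf b.src = c.tgt) → (blockOf b.tgt = c.src ∨ blockOf b.tgt = c.tgt) →
      ‖(fun b => mlog ((S' b : (Matrix n n ℂ)ˣ) : Matrix n n ℂ)) b - (fun b => mlog ((S b : (Matrix n n ℂ)ˣ) : Matrix n n ℂ)) b‖ ≤ 2 * ε :=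
    fun b h1 h2 => by
      have h := FederbushMean.norm_mlog_sub_mlog_le (ρ := s) (by linarith) (hS' b h1 h2) (hS b h1 h2)
      have h3 : s / (1 - s) ≤ 1 := by rw [div_le_one (by linarith)]; linarith
      have h4 : 0 ≤ s / (1 - s) := div_nonneg hs.le (by linarith)
      calc _ = ‖mlog ((S' b : (Matrix n n ℂ)ˣ) : Matrix n n ℂ) - mlog ((S b : (Matrix n n ℂ)ˣ) : Matrix n n ℂ)‖ := rfl
        _ ≤ (1 + s / (1 - s)) * ‖((S' b : (Matrix n n ℂ)ˣ) : Matrix n n ℂ) - ((S b : (Matrix n n ℂ)ˣ) : Matrix n n ℂ)‖ := h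
        _ ≤ 2 * ε := by
          nlinarith [norm_nonneg (((S' b : (Matrix n n ℂ)ˣ) : Matrix n n ℂ) - ((S b : (Matrix n n ℂ)ˣ) : Matrix n n ℂ)), hd b h1 h2]
  have key := norm_avgRemE_sub_avgRemE_le_local hj c (δ := 2 * s) (ε := 2 * ε) (by positivity) (by positivity) (by linarith) hY hY' hdY
  calc _ ≤ 21120 * (((P.d + 2) * P.L : ℕ) : ℝ) ^ 2 * (2 * s) * (2 * ε) := key
    _ = 84480 * (((P.d + 2) * P.L : ℕ) : ℝ) ^ 2 * s * ε := by ring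

end Rem

/-! ## §7  The `SU(N)` leg on the guard IS module 25's remainder (UST (T1) `coe_emlAvgU_unitsField`) -/

section SULeg

open scoped Matrix.Norms.L2Operator
open B10Eq27TorusAxialLog

variable {N : ℕ} [NeZero N]

/-- **THE `SU(N)` LEG**: for an `SU(N)`-valued field read in `GL_N(ℂ)` (`unitsField (toUField U)`) whose (0.4) loop variables at `c` are on the guard,
the functional `avgRemU` IS n18-d's module-25 remainder `Ū(c) − 1 − (Q₁(U − 1))(c)` with the GUARDED average `Ū = avgFun expMeanLogSU U` — so ★★ restricted
to `SU(N) × SU(N)` is module 25's statement up to the constant (UST (T1) `Prop8Chart.coe_emlAvgU_unitsField`). [cite: Balaban1987RG1, (0.4) p.253] -/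
theorem avgRemU_unitsField_eq (U : GaugeField P j (Matrix.specialUnitaryGroup (Fin N) ℂ)) (c : PBond P (j + 1))
    (hsmall : BlockAveraging.Small (expMeanLogSU (n := Fin N)) U c) :
    (((emlAvgU (unitsField (toUField U)) c : (Matrix (Fin N) (Fin N) ℂ)ˣ) : Matrix (Fin N) (Fin N) ℂ) - 1 - linAvg (fun b => (((unitsField (toUField U)) b : (Matrix (Fin N) (Fin N) ℂ)ˣ) : Matrix (Fin N) (Fin N) ℂ) - 1) c) =
      ((avgFun (expMeanLogSU (n := Fin N)) U c : Matrix.specialUnitaryGroup (Fin N) ℂ) : Matrix (Fin N) (Fin N) ℂ) - 1 -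
        linAvg (fun b => ((U b : Matrix.specialUnitaryGroup (Fin N) ℂ) : Matrix (Fin N) (Fin N) ℂ) - 1) c := by
  rw [coe_emlAvgU_unitsField U c hsmall]
  congr 2

end SULeg

end YMDAG.N18.AvgRemainderUnits

end
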